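import Summits.QuantumAdvantage.QuantumAdvantage.Theorems.CubicForrelationNearExactIsExactSixteenLevelSeven

/-!
# Crux `CubicForrelation.NearExactIsExact` (stmt-QuantumAdvantage-14043) — n = 16 two-sided analysis, SPLIT configurations: shared tools

Certificate seat `b2b-cforr-cert` (gen 6).  HONEST FRAMING: preparatory lemmas for theorems about cubic Boolean pairs on 16 bits (finite slice
`n = 16` of the crux; the split boundary configurations (sA), (sB), (sC) of `Φ = 31/32`) — NOT summit progress.

* `sp_loc2` (general `n`): LOCALISATION of a parametrised `(k+2)`-flat sum to its inner `k`-flat when the integrand vanishes on the three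
  translates by the two outer directions.
* `sp_H34` (`n = 16`): for cubic `f, g` with `W_g = 64u`, a coset `S = x₁ ⊕ V₀`, a pattern `e` with `u − 4(−1)^f = 2e` on `S`, and two outer
  directions `t₁, t₂` whose translates of `S` carry `u − 4(−1)^f = 0`: the general 5- and 6-flat sums (`fs_flat_sum_dvd`, Ax for `f`) give the
  hypotheses (H3) `4 ∣ Σ₃ e` and (H4) `8 ∣ Σ₄ e` of the engine `fl1_flat_l1`.
* `sp_affine_const_on_L` (general `n`): an affine function vanishing on the zero set `H` of a non-constant affine `d₀` is constant on `L = {d₀ = 1}`;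
  `sp_L_l1`: hence `(−1)^q·1_L` (for a quadratic `q` whose derivatives along a group `V'` of periods of `d₀` vanish on `H`) has
  `(Σ_y |((−1)^q 1_L)^(y)|)²·#V' ≤ 4ⁿ·#L` (`fp_l1_sq_mul_le` with `R = V'`).
* `sp_tau_one`, `sp_tau_three`: the residual `v − 4s` on odd points in terms of the digit `d₁ = [⌊v/2⌋ odd]`; `sp_W_add`.

References: J. Ax (1964) / R. J. McEliece (1972); R. O'Donnell (2014) §3.3.  Everything below is proved from Mathlib and the tree; axioms are
the standard three.
-/

set_option linter.dupNamespace false -- D-0017: single-problem summit ⇒ `QuantumAdvantage.QuantumAdvantage` by design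

noncomputable section

namespace Summit.QuantumAdvantage.QuantumAdvantage.Theorems.CubicForrelation.NearExactIsExact

open Finset
open Literature.Computability.QuantumComplexity
open Literature.Computability.QuantumComplexity.BuzetChailloux (bxor zeroVec bxor_bxor_cancel_left bxor_zeroVec zeroVec_bxor bxor_comm
  bxor_self)
open Literature.Computability.QuantumComplexity.DerivativeWalsh (W)

variable {n : ℕ}

/-! ### Localisation of flat sums -/

/-- **Localisation.** If `F` vanishes at the translates `q ⊕ t₁`, `q ⊕ t₂`, `q ⊕ t₂ ⊕ t₁` of every point `q` of the inner parametrised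
`k`-flat, the parametrised `(k+2)`-flat sum with outer directions `t₁, t₂` equals the inner `k`-flat sum. [folklore] -/
theorem sp_loc2 {k : ℕ} (F : (Fin n → Bool) → ℤ) (x t₁ t₂ : Fin n → Bool) (a : Fin k → Fin n → Bool)
    (h1 : ∀ ε : Fin k → Bool, F (bxor (fun j => x j ^^ decide (Odd #(univ.filter fun i => ε i && a i j))) t₁) = 0)
    (h2 : ∀ ε : Fin k → Bool, F (bxor (fun j => x j ^^ decide (Odd #(univ.filter fun i => ε i && a i j))) t₂) = 0)
    (h21 : ∀ ε : Fin k → Bool, F (bxor (bxor (fun j => x j ^^ decide (Odd #(univ.filter fun i => ε i && a i j))) t₂) t₁) = 0) :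
    ∑ ε : Fin (k + 2) → Bool, F (fun j => x j ^^ decide (Odd #(univ.filter fun i =>
        ε i && (Matrix.vecCons t₁ (Matrix.vecCons t₂ a) : Fin (k + 2) → Fin n → Bool) i j))) =
      ∑ ε : Fin k → Bool, F (fun j => x j ^^ decide (Odd #(univ.filter fun i => ε i && a i j))) := by
  have p1 := fr_sum_peel F x t₁ (Matrix.vecCons t₂ a)
  rw [p1]
  have p2 := fr_sum_peel F x t₂ a
  have p3 := fr_sum_peel (fun y => F (bxor y t₁)) x t₂ a
  beta_reduce at p3
  rw [p2, p3, sum_eq_zero fun ε _ => h2 ε, sum_eq_zero fun ε _ => h1 ε, sum_eq_zero fun ε _ => h21 ε]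
  ring

/-! ### (H3)/(H4) on 16 bits from general flat sums -/

/-- **The engine hypotheses from flat sums (16 bits).**  `f, g` cubic, `W_g = 64u`, `S = x₁ ⊕ V₀` a coset, `u − 4(−1)^f = 2e` on `S`, and two
directions `t₁, t₂` such that `u − 4(−1)^f` vanishes on `S ⊕ t₁`, `S ⊕ t₂`, `S ⊕ t₂ ⊕ t₁`.  Then every parametrised 3-flat sum of `e` inside
`S` is `≡ 0 (mod 4)` and every parametrised 4-flat sum is `≡ 0 (mod 8)` (from `8 ∣ Σ₅ u`, `16 ∣ Σ₆ u` and Ax `4 ∣ Σ (−1)^f` on 5- and 6-flats).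
[this work] -/
theorem sp_H34 (f g : (Fin (8 + 8) → Bool) → Bool) (hf : IsDegLeFun 3 f) (hg : IsDegLeFun 3 g) (u : (Fin (8 + 8) → Bool) → ℤ)
    (hu : ∀ x, W (fun y => signOf (g y)) x = (2 : ℝ) ^ 6 * (u x : ℝ)) (V₀ S : Finset (Fin (8 + 8) → Bool))
    (x₁ : Fin (8 + 8) → Bool) (h0 : zeroVec ∈ V₀) (hadd : ∀ a ∈ V₀, ∀ b ∈ V₀, bxor a b ∈ V₀) (hS : S = V₀.image (bxor x₁))
    (e : (Fin (8 + 8) → Bool) → ℤ) (t₁ t₂ : Fin (8 + 8) → Bool) (hFe : ∀ p ∈ S, u p - 4 * sZ (f p) = 2 * e p)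
    (hz1 : ∀ p ∈ S, u (bxor p t₁) - 4 * sZ (f (bxor p t₁)) = 0) (hz2 : ∀ p ∈ S, u (bxor p t₂) - 4 * sZ (f (bxor p t₂)) = 0)
    (hz21 : ∀ p ∈ S, u (bxor (bxor p t₂) t₁) - 4 * sZ (f (bxor (bxor p t₂) t₁)) = 0) :
    (∀ x ∈ S, ∀ a b c : Fin (8 + 8) → Bool, a ∈ V₀ → b ∈ V₀ → c ∈ V₀ →
      (4 : ℤ) ∣ ∑ ε : Fin 3 → Bool, e (fun j => x j ^^ decide (Odd #(univ.filter fun i =>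
        ε i && (![a, b, c] : Fin 3 → Fin (8 + 8) → Bool) i j)))) ∧
    (∀ x ∈ S, ∀ a₀ a₁ a₂ a₃ : Fin (8 + 8) → Bool, a₀ ∈ V₀ → a₁ ∈ V₀ → a₂ ∈ V₀ → a₃ ∈ V₀ →
      (8 : ℤ) ∣ ∑ ε : Fin 4 → Bool, e (fun j => x j ^^ decide (Odd #(univ.filter fun i =>
        ε i && (![a₀, a₁, a₂, a₃] : Fin 4 → Fin (8 + 8) → Bool) i j)))) := by
  classical
  have hPV : ∀ x, x ∈ S → ∀ a ∈ V₀, bxor x a ∈ S := fun x hx a ha => fl1_coset_vadd hadd hS hx ha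
  -- localisation for any inner flat inside `S`
  have hloc : ∀ {k : ℕ} (x : Fin (8 + 8) → Bool) (a : Fin k → Fin (8 + 8) → Bool),
      (∀ ε : Fin k → Bool, (fun j => x j ^^ decide (Odd #(univ.filter fun i => ε i && a i j))) ∈ S) →
      ∑ ε : Fin (k + 2) → Bool, (u (fun j => x j ^^ decide (Odd #(univ.filter fun i =>
          ε i && (Matrix.vecCons t₁ (Matrix.vecCons t₂ a) : Fin (k + 2) → Fin (8 + 8) → Bool) i j))) -
        4 * sZ (f (fun j => x j ^^ decide (Odd #(univ.filter fun i =>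
          ε i && (Matrix.vecCons t₁ (Matrix.vecCons t₂ a) : Fin (k + 2) → Fin (8 + 8) → Bool) i j))))) =
      ∑ ε : Fin k → Bool, 2 * e (fun j => x j ^^ decide (Odd #(univ.filter fun i => ε i && a i j))) := by
    intro k x a hin
    have key := sp_loc2 (fun y => u y - 4 * sZ (f y)) x t₁ t₂ a (fun ε => hz1 _ (hin ε)) (fun ε => hz2 _ (hin ε))
      (fun ε => hz21 _ (hin ε))
    beta_reduce at key
    rw [key]
    exact sum_congr rfl fun ε _ => hFe _ (hin ε)
  refine ⟨?_, ?_⟩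
  · intro x hx a b c ha hb hc
    have hin : ∀ ε : Fin 3 → Bool, (fun j => x j ^^ decide (Odd #(univ.filter fun i =>
        ε i && (![a, b, c] : Fin 3 → Fin (8 + 8) → Bool) i j))) ∈ S :=
      fun ε => fr_mem_flatPt3 V₀ h0 (· ∈ S) hPV hx ![a, b, c] (fun i => by fin_cases i <;> assumption) ε
    have h8 := fs_flat_sum_dvd (e := 3) g u hg hu x ![t₁, t₂, a, b, c] (by norm_num)
    obtain ⟨zf, hzf⟩ := sl_sum_sZ_flat f hf x ![t₁, t₂, a, b, c]
    have hzf' : ∑ ε : Fin 5 → Bool, 4 * sZ (f (fun j => x j ^^ decide (Odd #(univ.filter fun i =>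
          ε i && (![t₁, t₂, a, b, c] : Fin 5 → Fin (8 + 8) → Bool) i j)))) = 8 * (2 * zf) := by
      rw [← mul_sum, hzf]; norm_num; ring
    have h8n : (8 : ℤ) ∣ ∑ ε : Fin 5 → Bool, u (fun j => x j ^^ decide (Odd #(univ.filter fun i =>
          ε i && (![t₁, t₂, a, b, c] : Fin 5 → Fin (8 + 8) → Bool) i j))) := by
      have e8 : (2 : ℤ) ^ 3 = 8 := by norm_num
      rw [e8] at h8; exact h8
    have h8' : (8 : ℤ) ∣ ∑ ε : Fin 5 → Bool, (u (fun j => x j ^^ decide (Odd #(univ.filter fun i =>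
          ε i && (![t₁, t₂, a, b, c] : Fin 5 → Fin (8 + 8) → Bool) i j))) -
        4 * sZ (f (fun j => x j ^^ decide (Odd #(univ.filter fun i =>
          ε i && (![t₁, t₂, a, b, c] : Fin 5 → Fin (8 + 8) → Bool) i j))))) := by
      rw [sum_sub_distrib, hzf']
      exact dvd_sub h8n (Dvd.intro _ rfl)
    rw [hloc x ![a, b, c] hin, ← mul_sum] at h8'
    obtain ⟨k8, hk8⟩ := h8'
    exact ⟨k8, by linarith⟩
  · intro x hx a₀ a₁ a₂ a₃ ha₀ ha₁ ha₂ ha₃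
    have hin : ∀ ε : Fin 4 → Bool, (fun j => x j ^^ decide (Odd #(univ.filter fun i =>
        ε i && (![a₀, a₁, a₂, a₃] : Fin 4 → Fin (8 + 8) → Bool) i j))) ∈ S :=
      fun ε => fr_mem_flatPt4 V₀ h0 (· ∈ S) hPV hx ![a₀, a₁, a₂, a₃] (fun i => by fin_cases i <;> assumption) ε
    have h16 := fs_flat_sum_dvd (e := 4) g u hg hu x ![t₁, t₂, a₀, a₁, a₂, a₃] (by norm_num)
    obtain ⟨zf, hzf⟩ := sl_sum_sZ_flat f hf x ![t₁, t₂, a₀, a₁, a₂, a₃]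
    have hzf' : ∑ ε : Fin 6 → Bool, 4 * sZ (f (fun j => x j ^^ decide (Odd #(univ.filter fun i =>
          ε i && (![t₁, t₂, a₀, a₁, a₂, a₃] : Fin 6 → Fin (8 + 8) → Bool) i j)))) = 16 * zf := by
      rw [← mul_sum, hzf]; norm_num; ring
    have h16n : (16 : ℤ) ∣ ∑ ε : Fin 6 → Bool, u (fun j => x j ^^ decide (Odd #(univ.filter fun i =>
          ε i && (![t₁, t₂, a₀, a₁, a₂, a₃] : Fin 6 → Fin (8 + 8) → Bool) i j))) := by
      have e16 : (2 : ℤ) ^ 4 = 16 := by norm_num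
      rw [e16] at h16; exact h16
    have h16' : (16 : ℤ) ∣ ∑ ε : Fin 6 → Bool, (u (fun j => x j ^^ decide (Odd #(univ.filter fun i =>
          ε i && (![t₁, t₂, a₀, a₁, a₂, a₃] : Fin 6 → Fin (8 + 8) → Bool) i j))) -
        4 * sZ (f (fun j => x j ^^ decide (Odd #(univ.filter fun i =>
          ε i && (![t₁, t₂, a₀, a₁, a₂, a₃] : Fin 6 → Fin (8 + 8) → Bool) i j))))) := by
      rw [sum_sub_distrib, hzf']
      exact dvd_sub h16n (Dvd.intro _ rfl)
    rw [hloc x ![a₀, a₁, a₂, a₃] hin, ← mul_sum] at h16'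
    obtain ⟨k16, hk16⟩ := h16'
    exact ⟨k16, by linarith⟩

/-! ### Affine functions across the split `L ∣ H` -/

/-- **An affine function vanishing on `H = {d₀ = 0}` (`d₀` affine, `H ≠ ∅`) is constant on `L = {d₀ = 1}`.** [folklore] -/
theorem sp_affine_const_on_L (φ d₀ : (Fin n → Bool) → Bool) (hφ : IsDegLeFun 1 φ) (hd₀ : IsDegLeFun 1 d₀)
    (hH : ∀ h, d₀ h = false → φ h = false) {h₀ : Fin n → Bool} (hh₀ : d₀ h₀ = false)
    {x y : Fin n → Bool} (hx : d₀ x = true) (hy : d₀ y = true) : φ x = φ y := by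
  have hDφ := tc_const_of_deg_zero (stub_derivDegree n 0 φ (bxor y x) hφ) y h₀
  have hDd := tc_const_of_deg_zero (stub_derivDegree n 0 d₀ (bxor y x) hd₀) y h₀
  simp only [bxor_bxor_cancel_left] at hDφ hDd
  rw [hx, hy, hh₀] at hDd
  have hha : d₀ (bxor h₀ (bxor y x)) = false := by
    revert hDd; cases d₀ (bxor h₀ (bxor y x)) <;> decide
  rw [hH h₀ hh₀, hH _ hha] at hDφ
  revert hDφ; cases φ x <;> cases φ y <;> decide

/-- **`L¹` bound for `(−1)^q·1_L`.**  Let `d₀` be affine with `H = {d₀ = 0} ≠ ∅`, `q` quadratic, and `V' ∋ 0` a `⊕`-closed set of periods of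
`d₀` such that every derivative `D_a q`, `a ∈ V'`, vanishes on `H`.  Then `A = (−1)^q·1_{d₀ = 1}` has every `a ∈ V'` as a period up to sign, so
`(Σ_y |Â(y)|)²·#V' ≤ 2ⁿ·2ⁿ·#{d₀ = 1}`. [this work] -/
theorem sp_L_l1 (d₀ q : (Fin n → Bool) → Bool) (hd₀ : IsDegLeFun 1 d₀) (hq : IsDegLeFun 2 q) (V' : Finset (Fin n → Bool))
    (h0' : zeroVec ∈ V') (hadd' : ∀ a ∈ V', ∀ b ∈ V', bxor a b ∈ V') (hper : ∀ a ∈ V', ∀ x, d₀ (bxor x a) = d₀ x)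
    (hqH : ∀ a ∈ V', ∀ h, d₀ h = false → q (bxor h a) = q h) {h₀ : Fin n → Bool} (hh₀ : d₀ h₀ = false) :
    (∑ y, |W (fun x => if d₀ x = true then signOf (q x) else 0) y|) ^ 2 * #V' ≤
      (2 : ℝ) ^ n * 2 ^ n * #(univ.filter fun x : Fin n → Bool => d₀ x = true) := by
  classical
  refine fp_l1_sq_mul_le _ (univ.filter fun x : Fin n → Bool => d₀ x = true) V' (fun x hx => ?_) (fun x hx => ?_) h0' hadd'
    (fun a ha => ?_)
  · rw [if_pos (mem_filter.1 hx).2]; unfold signOf; split_ifs <;> simp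
  · have hx' : ¬ d₀ x = true := fun h => hx (mem_filter.2 ⟨mem_univ _, h⟩)
    rw [if_neg hx']
  · -- the derivative `D_a q` is affine, vanishes on `H`, hence is a constant `c` on `L`
    have hDq : IsDegLeFun 1 (fun y => q y ^^ q (bxor y a)) := stub_derivDegree n 1 q a hq
    have hDqH : ∀ h, d₀ h = false → (q h ^^ q (bxor h a)) = false := by
      intro h hh; rw [hqH a ha h hh]; cases q h <;> rfl
    by_cases hL : ∃ x₀, d₀ x₀ = true
    · obtain ⟨x₀, hx₀⟩ := hL
      refine ⟨signOf (q x₀ ^^ q (bxor x₀ a)), ?_, fun x => ?_⟩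
      · unfold signOf; split_ifs <;> simp
      · by_cases hx : d₀ x = true
        · have hxa : d₀ (bxor x a) = true := by rw [hper a ha x]; exact hx
          rw [if_pos hx, if_pos hxa]
          have hc := sp_affine_const_on_L _ d₀ hDq hd₀ hDqH hh₀ hx hx₀
          have hqa : q (bxor x a) = (q x ^^ (q x₀ ^^ q (bxor x₀ a))) := by
            rw [← hc]; cases q x <;> cases q (bxor x a) <;> rfl
          rw [hqa, signOf_xor]; ring
        · have hxa : ¬ d₀ (bxor x a) = true := by rw [hper a ha x]; exact hx
          rw [if_neg hx, if_neg hxa, mul_zero]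
    · push Not at hL
      refine ⟨1, Or.inl rfl, fun x => ?_⟩
      have h1 : ¬ d₀ x = true := by simpa using hL x
      have h2 : ¬ d₀ (bxor x a) = true := by simpa using hL (bxor x a)
      rw [if_neg h1, if_neg h2, mul_zero]

/-! ### The residual on odd points in terms of the digit `d₁` -/

/-- `|v − 4s| = 1` ⇒ `v − 4s = (−1)^{[⌊v/2⌋ odd]}`. [folklore] -/
theorem sp_tau_one {v s : ℤ} (h : v - 4 * s = 1 ∨ v - 4 * s = -1) :
    v - 4 * s = sZ (decide (Odd (v / 2))) := by
  rcases h with h | h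
  · have hv : v / 2 = 2 * s := by omega
    have hev : ¬ Odd (v / 2) := by rw [hv, Int.not_odd_iff_even]; exact even_two_mul _
    rw [h, decide_eq_false hev]; rfl
  · have hv : v / 2 = 2 * s - 1 := by omega
    have hod : Odd (v / 2) := by rw [hv]; exact ⟨s - 1, by ring⟩
    rw [h, decide_eq_true hod]; rfl

/-- `(v − 4s)² = 9` ⇒ `v − 4s = −3·(−1)^{[⌊v/2⌋ odd]}`. [folklore] -/
theorem sp_tau_three {v s : ℤ} (h : (v - 4 * s) ^ 2 = 9) :
    v - 4 * s = -3 * sZ (decide (Odd (v / 2))) := by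
  have h3 : v - 4 * s = 3 ∨ v - 4 * s = -3 := by
    have : (v - 4 * s - 3) * (v - 4 * s + 3) = 0 := by nlinarith
    rcases mul_eq_zero.1 this with h1 | h1
    · left; linarith
    · right; linarith
  rcases h3 with h3 | h3
  · have hv : v / 2 = 2 * s + 1 := by omega
    have hod : Odd (v / 2) := by rw [hv]; exact ⟨s, by ring⟩
    rw [h3, decide_eq_true hod]; rfl
  · have hv : v / 2 = 2 * s - 2 := by omega
    have hev : ¬ Odd (v / 2) := by rw [hv, Int.not_odd_iff_even]; exact ⟨s - 1, by ring⟩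
    rw [h3, decide_eq_false hev]; rfl

/-- Additivity of the transform. [folklore] -/
theorem sp_W_add (A B : (Fin n → Bool) → ℝ) (y : Fin n → Bool) : W (fun x => A x + B x) y = W A y + W B y := by
  unfold W
  rw [← sum_add_distrib]
  exact sum_congr rfl fun x _ => by ring

end Summit.QuantumAdvantage.QuantumAdvantage.Theorems.CubicForrelation.NearExactIsExact

end
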